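import Summits.KontsevichZagierPeriods.Zeta5Search.TwoTaleOmega.FormalBarnes

/-!
# Formal Barnes functionals Va — Euler layer and alternating weights for the second tale
(cell `pub-zeta5`, fam-tele gen 4)

HONEST FRAMING: systematic search; no irrationality claim unless certified.

OUR infrastructure (Summit side; finite algebra only), blueprint `families/tele/RECURRENCE.md §13.1 (TALE 2)`.
The polynomial and weight layers of the formal alternating sum `E_M[v] = "Σ_{m ≥ M} (−1)^m v(m)"` used by
`FormalBarnesT`: signs `sgnZ n = (−1)^n` (`n : ℤ`); Euler's transformation of the alternating sum of a polynomial,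
`ePoly d M Q = (−1)^M Σ_{ℓ ≤ d} (−1)^ℓ Δ^ℓ[Q](M)/2^{ℓ+1}`, with its SHIFT law (sign!) `ePoly_shift` and CROSSING law
`ePoly_crossing : E_M[Q] − E_{M+1}[Q] = (−1)^M Q(M)` (telescoping in `ℓ`); the alternating harmonic sums `A1, A2`
(definitionally the tree's `harmAlt1, harmAlt2`) and the pole weights `chi10, chi20, chi21 : ℤ → ℚ` with the reflection
rule and their crossing lemmas.
-/

noncomputable section

open Polynomial Finset fwdDiff

namespace Summit.KontsevichZagierPeriods.Zeta5Search.FormalBarnes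

/-! ### Signs -/

/-- `(−1)^n` for `n : ℤ`. -/
def sgnZ (n : ℤ) : ℚ := (-1 : ℚ) ^ n

/-- `(−1)^{n+1} = −(−1)^n`. -/
theorem sgnZ_succ (n : ℤ) : sgnZ (n + 1) = -sgnZ n := by
  unfold sgnZ; rw [zpow_add_one₀ (by norm_num : (-1 : ℚ) ≠ 0)]; ring

/-- `(−1)^{m+n} = (−1)^m (−1)^n`. -/
theorem sgnZ_add (m n : ℤ) : sgnZ (m + n) = sgnZ m * sgnZ n := by
  unfold sgnZ; rw [zpow_add₀ (by norm_num : (-1 : ℚ) ≠ 0)]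

/-- `(−1)^n (−1)^n = 1`. -/
theorem sgnZ_mul_self (n : ℤ) : sgnZ n * sgnZ n = 1 := by
  rw [← sgnZ_add, ← two_mul]; unfold sgnZ; rw [zpow_mul]; norm_num

/-- `(−1)^{−n} = (−1)^n`. -/
theorem sgnZ_neg (n : ℤ) : sgnZ (-n) = sgnZ n := by
  have h := sgnZ_mul_self n
  unfold sgnZ at *
  rw [zpow_neg]
  exact inv_eq_of_mul_eq_one_right h

/-- `(−1)^{2k} = 1`. -/
theorem sgnZ_two_mul (k : ℤ) : sgnZ (2 * k) = 1 := by
  rw [two_mul, sgnZ_add, sgnZ_mul_self]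

/-- `sgnZ` on natural numbers is the ordinary power. -/
theorem sgnZ_natCast (n : ℕ) : sgnZ (n : ℤ) = (-1) ^ n := by
  unfold sgnZ; rw [zpow_natCast]

/-! ### Polynomial layer: Euler's transformation of `Σ_{m ≥ M} (−1)^m Q(m)` -/

/-- `ePoly d M Q = (−1)^M Σ_{ℓ ≤ d} (−1)^ℓ Δ^ℓ[Q](M) / 2^{ℓ+1}`. -/
def ePoly (d : ℕ) (M : ℤ) (Q : ℚ[X]) : ℚ :=
  sgnZ M * ∑ ℓ ∈ range (d + 1), (-1) ^ ℓ * ((fwdDiff (1 : ℚ))^[ℓ] (fun t => Q.eval t) M) / 2 ^ (ℓ + 1)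

/-- The Euler layer does not depend on the truncation `d ≥ deg Q`. -/
theorem ePoly_eq_of_le (Q : ℚ[X]) (M : ℤ) {d d' : ℕ} (hd : Q.natDegree ≤ d) (hdd : d ≤ d') :
    ePoly d' M Q = ePoly d M Q := by
  unfold ePoly
  congr 1
  rw [← sum_range_add_sum_Ico _ (Nat.succ_le_succ hdd)]
  have hz : ∑ ℓ ∈ Ico (d + 1) (d' + 1),
      (-1) ^ ℓ * ((fwdDiff (1 : ℚ))^[ℓ] (fun t => Q.eval t) M) / 2 ^ (ℓ + 1) = 0 := by
    refine sum_eq_zero fun ℓ hℓ => ?_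
    have hlt : Q.natDegree < ℓ := lt_of_lt_of_le (Nat.lt_succ_of_le hd) (mem_Ico.1 hℓ).1
    have := congrFun (Polynomial.fwdDiff_iter_eq_zero_of_degree_lt (P := Q) hlt) M
    simp only [Pi.zero_apply] at this
    rw [show (fun t => Q.eval t) = Q.eval from rfl, this]; simp
  rw [hz, add_zero]

/-- Additivity of the Euler layer in `Q`. -/
theorem ePoly_add (d : ℕ) (M : ℤ) (Q₁ Q₂ : ℚ[X]) : ePoly d M (Q₁ + Q₂) = ePoly d M Q₁ + ePoly d M Q₂ := by
  unfold ePoly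
  have key : ∀ ℓ : ℕ, (fwdDiff (1 : ℚ))^[ℓ] (fun t => (Q₁ + Q₂).eval t) M
      = (fwdDiff (1 : ℚ))^[ℓ] (fun t => Q₁.eval t) M + (fwdDiff (1 : ℚ))^[ℓ] (fun t => Q₂.eval t) M := by
    intro ℓ
    have : (fun t => (Q₁ + Q₂).eval t) = (fun t => Q₁.eval t) + fun t => Q₂.eval t := by
      funext t; simp
    rw [this, fwdDiff_iter_add]
    simp only [Pi.add_apply]
  simp_rw [key]
  rw [← mul_add, ← sum_add_distrib]
  congr 1
  exact sum_congr rfl fun ℓ _ => by ring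

/-- Homogeneity of the Euler layer in `Q`. -/
theorem ePoly_smul (d : ℕ) (M : ℤ) (c : ℚ) (Q : ℚ[X]) : ePoly d M (C c * Q) = c * ePoly d M Q := by
  unfold ePoly
  have key : ∀ ℓ : ℕ, (fwdDiff (1 : ℚ))^[ℓ] (fun t => (C c * Q).eval t) M
      = c * (fwdDiff (1 : ℚ))^[ℓ] (fun t => Q.eval t) M := by
    intro ℓ
    have : (fun t => (C c * Q).eval t) = c • fun t => Q.eval t := by
      funext t; simp
    rw [this, fwdDiff_iter_const_smul]
    simp only [Pi.smul_apply, smul_eq_mul]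
  simp_rw [key]
  have hs : ∑ ℓ ∈ range (d + 1), (-1) ^ ℓ * (c * (fwdDiff (1 : ℚ))^[ℓ] (fun t => Q.eval t) M) / 2 ^ (ℓ + 1)
      = c * ∑ ℓ ∈ range (d + 1), (-1) ^ ℓ * ((fwdDiff (1 : ℚ))^[ℓ] (fun t => Q.eval t) M) / 2 ^ (ℓ + 1) := by
    rw [mul_sum]
    exact sum_congr rfl fun ℓ _ => by ring
  rw [hs]
  ring

/-- One-step SHIFT law for the polynomial part (note the sign). -/
theorem ePoly_shift (d : ℕ) (M : ℤ) (Q : ℚ[X]) : ePoly d M (Q.comp (X + 1)) = -ePoly d (M + 1) Q := by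
  unfold ePoly
  rw [sgnZ_succ, neg_mul, neg_neg]
  congr 1
  refine sum_congr rfl fun ℓ _ => ?_
  have : (fun t => (Q.comp (X + 1)).eval t) = fun r => (fun u => Q.eval u) (r + 1) := by
    funext t; simp [eval_comp]
  rw [this, fwdDiff_iter_comp_add (1 : ℚ) (fun u => Q.eval u) 1 ℓ M]
  push_cast
  ring_nf

/-- CROSSING law for the polynomial part: `E_M[Q] − E_{M+1}[Q] = (−1)^M Q(M)` (`deg Q ≤ d`), by telescoping. -/
theorem ePoly_crossing (d : ℕ) (M : ℤ) (Q : ℚ[X]) (hd : Q.natDegree ≤ d) :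
    ePoly d M Q - ePoly d (M + 1) Q = sgnZ M * Q.eval (M : ℚ) := by
  unfold ePoly
  rw [sgnZ_succ]
  push_cast
  set f : ℕ → ℚ := fun ℓ => (-1) ^ ℓ * ((fwdDiff (1 : ℚ))^[ℓ] (fun t => Q.eval t) M) / 2 ^ ℓ with hf
  have hstep : ∀ ℓ : ℕ, (-1) ^ ℓ * ((fwdDiff (1 : ℚ))^[ℓ] (fun t => Q.eval t) M) / 2 ^ (ℓ + 1)
      + (-1) ^ ℓ * ((fwdDiff (1 : ℚ))^[ℓ] (fun t => Q.eval t) ((M : ℚ) + 1)) / 2 ^ (ℓ + 1) = f ℓ - f (ℓ + 1) := by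
    intro ℓ
    have hs : (fwdDiff (1 : ℚ))^[ℓ + 1] (fun t => Q.eval t) M
        = (fwdDiff (1 : ℚ))^[ℓ] (fun t => Q.eval t) ((M : ℚ) + 1) - (fwdDiff (1 : ℚ))^[ℓ] (fun t => Q.eval t) M := by
      rw [Function.iterate_succ_apply']; rfl
    simp only [hf, hs, pow_succ]
    ring
  have htel : ∑ ℓ ∈ range (d + 1), (f ℓ - f (ℓ + 1)) = f 0 - f (d + 1) := sum_range_sub' f (d + 1)
  have hfd : f (d + 1) = 0 := by
    have hlt : Q.natDegree < d + 1 := Nat.lt_succ_of_le hd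
    have := congrFun (Polynomial.fwdDiff_iter_eq_zero_of_degree_lt (P := Q) hlt) M
    simp only [Pi.zero_apply] at this
    simp only [hf]
    rw [show (fun t => Q.eval t) = Q.eval from rfl, this]; simp
  have hf0 : f 0 = Q.eval (M : ℚ) := by simp [hf]
  calc sgnZ M * ∑ ℓ ∈ range (d + 1), (-1) ^ ℓ * ((fwdDiff (1 : ℚ))^[ℓ] (fun t => Q.eval t) M) / 2 ^ (ℓ + 1)
        - -sgnZ M * ∑ ℓ ∈ range (d + 1), (-1) ^ ℓ * ((fwdDiff (1 : ℚ))^[ℓ] (fun t => Q.eval t) ((M : ℚ) + 1)) / 2 ^ (ℓ + 1)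
      = sgnZ M * ∑ ℓ ∈ range (d + 1), (f ℓ - f (ℓ + 1)) := by
        rw [← sum_congr rfl fun ℓ _ => hstep ℓ, sum_add_distrib]; ring
    _ = sgnZ M * Q.eval (M : ℚ) := by rw [htel, hfd, hf0, sub_zero]

/-! ### Alternating harmonic sums and the polar weights -/

/-- `Σ_{l=1}^{m} (−1)^{l−1}/l` (definitionally `Zudilin2014.SecondTale.harmAlt1`). -/
def A1 (m : ℕ) : ℚ := ∑ l ∈ range m, (-1) ^ l / (l + 1 : ℚ)

/-- `Σ_{l=1}^{m} (−1)^{l−1}/l²` (definitionally `Zudilin2014.SecondTale.harmAlt2`). -/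
def A2 (m : ℕ) : ℚ := ∑ l ∈ range m, (-1) ^ l / ((l + 1 : ℚ) ^ 2)

/-- Recursion `A₁(m+1) = A₁(m) + (−1)^m/(m+1)`. -/
theorem A1_succ (m : ℕ) : A1 (m + 1) = A1 m + (-1) ^ m / (m + 1 : ℚ) := by unfold A1; rw [sum_range_succ]
/-- Recursion `A₂(m+1) = A₂(m) + (−1)^m/(m+1)²`. -/
theorem A2_succ (m : ℕ) : A2 (m + 1) = A2 m + (-1) ^ m / ((m + 1 : ℚ) ^ 2) := by unfold A2; rw [sum_range_succ]

/-- `1`-coordinate of `E[1/(u+K)]` up to the factor `(−1)^K`; argument `m = K + M − 1`. -/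
def chi10 : ℤ → ℚ
  | Int.ofNat n => A1 n
  | Int.negSucc n => A1 n

/-- `1`-coordinate of `E[1/(u+K)²]` up to `(−1)^K`. -/
def chi20 : ℤ → ℚ
  | Int.ofNat n => A2 n
  | Int.negSucc n => -A2 n

/-- `η₂`-coordinate of `E[1/(u+K)²]` up to `(−1)^K` (the `η`-coordinate of `E[1/(u+K)]` is the constant `−1`). -/
def chi21 : ℤ → ℚ
  | Int.ofNat _ => -1
  | Int.negSucc _ => 1

/-- Crossing of the simple-pole weight: `χ¹⁰(m) − χ¹⁰(m+1) = (−1)^{m+1}/(m+1)` (`= 0` at `m = −1` by `x/0 = 0`). -/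
theorem chi10_crossing (m : ℤ) : chi10 m - chi10 (m + 1) = sgnZ (m + 1) / ((m : ℚ) + 1) := by
  rcases m with n | n
  · show A1 n - A1 (n + 1) = sgnZ ((n : ℤ) + 1) / (((n : ℤ) : ℚ) + 1)
    rw [A1_succ, show ((n : ℤ) + 1) = ((n + 1 : ℕ) : ℤ) by push_cast; ring, sgnZ_natCast, pow_succ]
    push_cast; ring
  · rcases n with _ | n
    · show A1 0 - A1 0 = sgnZ (Int.negSucc 0 + 1) / (((Int.negSucc 0 : ℤ) : ℚ) + 1)
      simp
    · show A1 (n + 1) - A1 n = sgnZ (Int.negSucc (n + 1) + 1) / (((Int.negSucc (n + 1) : ℤ) : ℚ) + 1)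
      have e1 : (Int.negSucc (n + 1) + 1 : ℤ) = -((n + 1 : ℕ) : ℤ) := by rw [Int.negSucc_eq]; push_cast; ring
      have e2 : (((Int.negSucc (n + 1) : ℤ) : ℚ) + 1) = -((n : ℚ) + 1) := by push_cast; ring
      rw [A1_succ, e1, sgnZ_neg, sgnZ_natCast, e2, pow_succ]
      have h : ((n : ℚ) + 1) ≠ 0 := by positivity
      field_simp
      ring

/-- Crossing of the double-pole weight: `χ²⁰(m) − χ²⁰(m+1) = (−1)^{m+1}/(m+1)²` (`= 0` at `m = −1`). -/
theorem chi20_crossing (m : ℤ) : chi20 m - chi20 (m + 1) = sgnZ (m + 1) / ((m : ℚ) + 1) ^ 2 := by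
  rcases m with n | n
  · show A2 n - A2 (n + 1) = sgnZ ((n : ℤ) + 1) / (((n : ℤ) : ℚ) + 1) ^ 2
    rw [A2_succ, show ((n : ℤ) + 1) = ((n + 1 : ℕ) : ℤ) by push_cast; ring, sgnZ_natCast, pow_succ]
    push_cast; ring
  · rcases n with _ | n
    · show -A2 0 - A2 0 = sgnZ (Int.negSucc 0 + 1) / (((Int.negSucc 0 : ℤ) : ℚ) + 1) ^ 2
      simp [A2]
    · show -A2 (n + 1) - -A2 n = sgnZ (Int.negSucc (n + 1) + 1) / (((Int.negSucc (n + 1) : ℤ) : ℚ) + 1) ^ 2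
      have e1 : (Int.negSucc (n + 1) + 1 : ℤ) = -((n + 1 : ℕ) : ℤ) := by rw [Int.negSucc_eq]; push_cast; ring
      have e2 : (((Int.negSucc (n + 1) : ℤ) : ℚ) + 1) = -((n : ℚ) + 1) := by push_cast; ring
      rw [A2_succ, e1, sgnZ_neg, sgnZ_natCast, e2, pow_succ]
      have h : ((n : ℚ) + 1) ≠ 0 := by positivity
      field_simp
      ring

/-- Crossing of the `η₂`-weight: jumps by `2` exactly at `m = −1` (the pole sitting at the node). -/
theorem chi21_crossing (m : ℤ) : chi21 m - chi21 (m + 1) = if m = -1 then 2 else 0 := by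
  rcases m with n | n
  · show chi21 (Int.ofNat n) - chi21 (Int.ofNat (n + 1)) = _
    have : (Int.ofNat n : ℤ) ≠ -1 := by simp
    simp [chi21]
  · rcases n with _ | n
    · show chi21 (Int.negSucc 0) - chi21 (Int.ofNat 0) = _
      simp [chi21]; norm_num
    · show chi21 (Int.negSucc (n + 1)) - chi21 (Int.negSucc n) = _
      have : Int.negSucc (n + 1) ≠ -1 := by simp [Int.negSucc_eq]; omega
      simp [chi21, this]

end Summit.KontsevichZagierPeriods.Zeta5Search.FormalBarnes
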